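import Summits.Parity.BatemanHorn.Theses.HurwitzTauber

/-!
# Birth skeleton (BC3) for crux `HurwitzTauber.SlowDecrease` (stmt-Parity-19023)

Crux (FIXED; concluded BY NAME by `SlowDecrease_of` below): for every Bateman–Horn system
`f = (f₁,…,f_k)` and every `ε > 0` there are `δ > 0`, `N₀` with
`F(N') ≥ F(N) − ε` whenever `N₀ ≤ N ≤ N' ≤ N^(1+δ)`, where
`F(N) = N⁻¹ Σ_{1 ≤ n ≤ N} ∏ᵢ Λ(fᵢ(n))` is the Λ-weighted prime-value density — R. Schmidt's
ONE-sided slow decrease of `F` in the variable `u = log N` (`[N, N^(1+δ)] = [u, (1+δ)u]`), the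
Tauberian input that route HurwitzTauber names as the price of passing from the logarithmic mean
(Karamata) to the Cesàro mean (support `SchmidtScales`).

## The line (`birth` = the route's own two-layer plan "TransferStub → CountSlowDecrease →
## SlowDecrease (ε/3)", route header TWO-LAYER PLAN)

Write `D = ∏ᵢ deg fᵢ`, `π_f(N) = polyPrimeCount f N = #{0 ≤ n ≤ N : every fᵢ(n) a (positive)
prime}` (the Literature counting function of `BatemanHornAsymptotic`) and
`G(N) = D · (log N)^k · π_f(N) / N` — the prime-COUNT density in the Bateman–Horn normalisation
(`BatemanHornAsymptotic f` reads `G(N) → C(f)`; `F(N) → C(f)` is its Λ-form).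

* `stub_lambdaCountTransfer` (theorem-grade, size M–L, provable now from TREE material):
  `F(N) − G(N) → 0` for every Bateman–Horn system.  Three inputs, all landed:
  (i) tuples with some `fᵢ(n)` a PROPER prime power number `≤ K x^(7/8)`
  (`Summit.Parity.BatemanHorn.LambdaToCount.card_filter_bad_le`, Bombieri–Pila on `Y^a = fᵢ(X)`),
  and each carries weight `≤ ∏ log fᵢ(n) ≤ (c log N)^k`, so they cost `o(N)`;
  (ii) on prime tuples `∏ Λ(fᵢ(n)) = ∏ log fᵢ(n) = D (log n)^k (1 + o(1))`
  (`LambdaToCount.isEquivalent_prod_log`);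
  (iii) `Σ_{prime tuples n ≤ N} [(log N)^k − (log n)^k] = k ∫₁^N π_f(t) (log t)^(k−1) dt/t = O(N/log N)`
  by Abel summation and the Brun upper bound `π_f(t) ≪ t/(log t)^k`
  (`Literature.NumberTheory.Sieve.polyPrimeCount_le_brunSieve_holds`); the `n = 0` term of
  `polyPrimeCount` costs `D (log N)^k / N → 0`.  (k = 0: `F ≡ 1`, `G(N) = (N+1)/N`.)
* `stub_countSlowDecrease` (LOAD-BEARING, open-problem strength, = the crux transported to the
  count): for every Bateman–Horn system and `ε > 0` there are `δ > 0`, `N₀` with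
  `G(N') ≥ G(N) − ε` for `N₀ ≤ N ≤ N' ≤ N^(1+δ)`: the normalised prime-value COUNT density cannot
  drop by `ε` between the scales `N` and `N^(1+δ)`.
* Composition `slowDecrease_of_parts` (REAL proof, ε/3): `F(N') ≥ G(N') − ε/3 ≥ G(N) − 2ε/3 ≥ F(N) − ε`
  for `N ≥ max(N₁, N₂)`; `SlowDecrease_of : SlowDecrease` feeds the two stubs in.

## Why this cut, and what it does NOT do (honesty record for the re-audit)

The cut separates the Λ/prime-power/log-weight BOOKKEEPING (stub 1: where Bombieri–Pila, the
`log fᵢ(n) ~ deg fᵢ · log n` equivalence and the Brun–Titchmarsh-type upper bound enter — all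
parity-free and all in the tree) from the OPEN content, which is then a statement about the prime
COUNT `π_f` alone (stub 2) — the object on which lower-bound sieve technology, almost-prime
results and any future scale-comparison principle operate.  It does NOT make the crux easier:
modulo stub 1 the count form is EQUIVALENT to the crux (`countSlowDecrease_of_slowDecrease`
below, kernel-checked, same ε/3) — exactly as the route header says ("SlowDecrease is implied by
BH but no scale-comparison principle for prime values of a fixed polynomial is known").  No
two-piece split of a one-sided Tauberian condition into two OPEN, mutually non-implying pieces is
known short of `BatemanHornAsymptotic` itself (upper half `limsup G ≤ C` ∧ lower half
`liminf G ≥ C` would be BH in costume; range-slicing `N' ≤ N(log N)^A` / beyond chains (one-sided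
conditions compose over two steps) but no tool owns either range).  Recorded, not hidden.

BC3 probes (folder `bc/probe_*.lean`, verdicts in `Lines/birth.md`): for each stub,
`stub → SlowDecrease` and `stub → BatemanHorn` by `first | exact? | simpa | aesop` (and each tactic
alone, folded and unfolded, `exact?` up to 2 000 000 heartbeats) all FAIL — no stub is cheaply the
crux or the summit.

Disproof / negatives / barriers: `ledger crux ls stmt-Parity-19023` had no workfiles (no
`Disproof.lean`, no `_false_without_` theorem, no landed `Theorems/SlowDecrease/Negative/*`);
`ledger negatives --problem Parity` = 3 GHL statements of unrelated shape.  Barriers: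
`Literature.Barriers.Parity.LogarithmicAveraging` is the barrier this crux ANSWERS (it is the
"genuine second input"; Hall's set shows it is not automatic for bounded non-negative sequences) —
stub 2 inherits exactly that status for `π_f`; `SelbergParityBarrier`: stub 2 is ghost-violable
(a Selberg-type sifted set with a parity parameter drifting on the scale `N → N^(1+δ)` violates it),
hence NOT a consequence of Type-I information — parity-sensitive though value-free, as the route
flags; `UniformBatemanHornBarrier`: every statement is per-system; stub 1 is parity-free
bookkeeping outside every catalogued class.
-/

namespace Summit.Parity.BatemanHorn.Cruxes.SlowDecrease.Birth

open scoped BigOperators Topology Classical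
open Filter Asymptotics
open Literature.NumberTheory.Sieve
open Summit.Parity.BatemanHorn.Theses.HurwitzTauber (SlowDecrease)

set_option linter.unusedVariables false

/-! ## The stubs -/

/-- **Stub 1 — `stub_lambdaCountTransfer` (theorem-grade, size M–L, provable now).**
For every Bateman–Horn system `f = (f₁,…,f_k)`,
`N⁻¹ Σ_{1≤n≤N} ∏ᵢ Λ(fᵢ(n)) − (∏ᵢ deg fᵢ) (log N)^k · polyPrimeCount f N / N → 0` as `N → ∞`:
the Λ-weighted prime-value density and the Bateman–Horn-normalised prime-COUNT density are
asymptotically equal.  Proper prime-power values are `≪ x^(7/8)` in number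
(`LambdaToCount.card_filter_bad_le`, Bombieri–Pila) with weights `≤ (c log N)^k`; on prime tuples
`∏Λ(fᵢ(n)) = ∏ log fᵢ(n) = (∏ deg fᵢ)(log n)^k (1+o(1))` (`LambdaToCount.isEquivalent_prod_log`);
`Σ_{prime tuples ≤ N} [(log N)^k − (log n)^k] = O(N/log N)` by Abel summation and the Brun bound
`polyPrimeCount_le_brunSieve_holds`; the `n = 0` term of `polyPrimeCount` is `O((log N)^k/N)`.
[BatemanHornMathComp1962, Tenenbaum2015, stmt-Parity-0874] -/
theorem stub_lambdaCountTransfer :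
    ∀ (k : ℕ) (f : Fin k → Polynomial ℤ), Literature.NumberTheory.Sieve.IsBatemanHornSystem f →
      Filter.Tendsto (fun N : ℕ => (∑ n ∈ Finset.Icc 1 N, ∏ i, ArithmeticFunction.vonMangoldt (((f i).eval (n : ℤ)).toNat)) / N - (∏ i, ((f i).natDegree : ℝ)) * Real.log N ^ k * (Literature.NumberTheory.Sieve.polyPrimeCount f N : ℝ) / N) Filter.atTop (nhds 0) := by
  sorry

/-- **Stub 2 — `stub_countSlowDecrease` (LOAD-BEARING; open-problem strength; the crux in the
count normalisation).**  For every Bateman–Horn system `f = (f₁,…,f_k)` and every `ε > 0` there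
are `δ > 0` and `N₀` such that, with `G(N) = (∏ᵢ deg fᵢ) (log N)^k · polyPrimeCount f N / N`,
`G(N') ≥ G(N) − ε` whenever `N₀ ≤ N ≤ N' ≤ N^(1+δ)`: Schmidt's one-sided slow decrease, on the
multiplicative scales `N → N^(1+δ)`, of the normalised COUNT of simultaneous prime values.
Implied by `BatemanHornAsymptotic f` (`G → C(f)`); no scale-comparison principle for prime values
of a fixed non-linear polynomial is known; ghost-violable (parity-sensitive), value-free.
Why it might be easier to ATTACK than the Λ-form: it is a statement about the set
`{n : all fᵢ(n) prime}` only — prime powers and log-weights are gone — so lower-bound sieve /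
almost-prime / dense-cluster technology applies to it verbatim.  (k = 0: `G(N) = (N+1)/N`, true.)
[Schmidt1925, Korevaar2004, TaoTeravainen2019AlmostAllScales, Literature.Barriers.Parity.LogarithmicAveraging] -/
theorem stub_countSlowDecrease :
    ∀ (k : ℕ) (f : Fin k → Polynomial ℤ), Literature.NumberTheory.Sieve.IsBatemanHornSystem f →
      ∀ ε : ℝ, 0 < ε → ∃ δ : ℝ, 0 < δ ∧ ∃ N₀ : ℕ, ∀ N N' : ℕ, N₀ ≤ N → N ≤ N' → (N' : ℝ) ≤ (N : ℝ) ^ (1 + δ) → (∏ i, ((f i).natDegree : ℝ)) * Real.log N ^ k * (Literature.NumberTheory.Sieve.polyPrimeCount f N : ℝ) / N - ε ≤ (∏ i, ((f i).natDegree : ℝ)) * Real.log N' ^ k * (Literature.NumberTheory.Sieve.polyPrimeCount f N' : ℝ) / N' := by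
  sorry

/-! ## Composition (REAL proof): the two stub STATEMENTS imply the crux -/

/-- **Composition in hypothesis form (ε/3).**  If the Λ-density `F` and the count density `G`
differ by `o(1)` (statement of stub 1) and `G` is slowly decreasing on the scales `N → N^(1+δ)`
(statement of stub 2), then `F` is slowly decreasing on the same scales with the same `δ`:
for `N ≥ max(N₁, N₂)` and `N ≤ N' ≤ N^(1+δ)`,
`F(N') ≥ G(N') − ε/3 ≥ G(N) − 2ε/3 ≥ F(N) − ε`.  The conclusion is the crux BODY verbatim (the
route decl `SlowDecrease` unfolds to it definitionally; `SlowDecrease_of` below is the by-name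
theorem the skeleton check reads). -/
theorem slowDecrease_of_parts
    (h₁ : ∀ (k : ℕ) (f : Fin k → Polynomial ℤ), Literature.NumberTheory.Sieve.IsBatemanHornSystem f →
      Filter.Tendsto (fun N : ℕ => (∑ n ∈ Finset.Icc 1 N, ∏ i, ArithmeticFunction.vonMangoldt (((f i).eval (n : ℤ)).toNat)) / N - (∏ i, ((f i).natDegree : ℝ)) * Real.log N ^ k * (Literature.NumberTheory.Sieve.polyPrimeCount f N : ℝ) / N) Filter.atTop (nhds 0))
    (h₂ : ∀ (k : ℕ) (f : Fin k → Polynomial ℤ), Literature.NumberTheory.Sieve.IsBatemanHornSystem f →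
      ∀ ε : ℝ, 0 < ε → ∃ δ : ℝ, 0 < δ ∧ ∃ N₀ : ℕ, ∀ N N' : ℕ, N₀ ≤ N → N ≤ N' → (N' : ℝ) ≤ (N : ℝ) ^ (1 + δ) → (∏ i, ((f i).natDegree : ℝ)) * Real.log N ^ k * (Literature.NumberTheory.Sieve.polyPrimeCount f N : ℝ) / N - ε ≤ (∏ i, ((f i).natDegree : ℝ)) * Real.log N' ^ k * (Literature.NumberTheory.Sieve.polyPrimeCount f N' : ℝ) / N') :
    ∀ (k : ℕ) (f : Fin k → Polynomial ℤ), Literature.NumberTheory.Sieve.IsBatemanHornSystem f →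
      ∀ ε : ℝ, 0 < ε → ∃ δ : ℝ, 0 < δ ∧ ∃ N₀ : ℕ, ∀ N N' : ℕ, N₀ ≤ N → N ≤ N' → (N' : ℝ) ≤ (N : ℝ) ^ (1 + δ) → (∑ n ∈ Finset.Icc 1 N, ∏ i, ArithmeticFunction.vonMangoldt (((f i).eval (n : ℤ)).toNat)) / N - ε ≤ (∑ n ∈ Finset.Icc 1 N', ∏ i, ArithmeticFunction.vonMangoldt (((f i).eval (n : ℤ)).toNat)) / N' := by
  intro k f hf ε hε
  have h3 : (0 : ℝ) < ε / 3 := by positivity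
  -- δ and N₂ from the count form at ε/3
  obtain ⟨δ, hδ, N₂, hN₂⟩ := h₂ k f hf (ε / 3) h3
  -- N₁ from the transfer at ε/3
  obtain ⟨N₁, hN₁⟩ := Metric.tendsto_atTop.mp (h₁ k f hf) (ε / 3) h3
  refine ⟨δ, hδ, max N₁ N₂, fun N N' hN hNN' hN' => ?_⟩
  have hA := hN₁ N (le_of_max_le_left hN)
  have hB := hN₁ N' ((le_of_max_le_left hN).trans hNN')
  have hC := hN₂ N N' (le_of_max_le_right hN) hNN' hN'
  rw [Real.dist_eq, sub_zero, abs_lt] at hA hB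
  linarith [hA.1, hA.2, hB.1, hB.2, hC]

/-- **The line concludes the crux BY NAME** (the `#h21_check_skeleton` theorem): the two registered
stubs, fed to `slowDecrease_of_parts`, give `Summit.Parity.BatemanHorn.Theses.HurwitzTauber.SlowDecrease`.
No `sorry` of its own; its axiom closure contains `sorryAx` exactly through the two `stub_*`. -/
theorem SlowDecrease_of : SlowDecrease :=
  slowDecrease_of_parts stub_lambdaCountTransfer stub_countSlowDecrease

/-! ## Honesty record (kernel-checked): modulo the transfer, the count form IS the crux -/

/-- **Converse bookkeeping.**  The crux `SlowDecrease` together with the statement of stub 1 gives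
back the statement of stub 2 (same ε/3 argument with the roles of `F` and `G` exchanged).  Hence
`stub_countSlowDecrease` is EQUIVALENT to the crux modulo the theorem-grade transfer: the skeleton
relocates the open content onto the prime count, it does not shrink it.  (Uses no `sorry`: it is
stated in hypothesis form.) -/
theorem countSlowDecrease_of_slowDecrease
    (hS : SlowDecrease)
    (h₁ : ∀ (k : ℕ) (f : Fin k → Polynomial ℤ), Literature.NumberTheory.Sieve.IsBatemanHornSystem f →
      Filter.Tendsto (fun N : ℕ => (∑ n ∈ Finset.Icc 1 N, ∏ i, ArithmeticFunction.vonMangoldt (((f i).eval (n : ℤ)).toNat)) / N - (∏ i, ((f i).natDegree : ℝ)) * Real.log N ^ k * (Literature.NumberTheory.Sieve.polyPrimeCount f N : ℝ) / N) Filter.atTop (nhds 0)) :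
    ∀ (k : ℕ) (f : Fin k → Polynomial ℤ), Literature.NumberTheory.Sieve.IsBatemanHornSystem f →
      ∀ ε : ℝ, 0 < ε → ∃ δ : ℝ, 0 < δ ∧ ∃ N₀ : ℕ, ∀ N N' : ℕ, N₀ ≤ N → N ≤ N' → (N' : ℝ) ≤ (N : ℝ) ^ (1 + δ) → (∏ i, ((f i).natDegree : ℝ)) * Real.log N ^ k * (Literature.NumberTheory.Sieve.polyPrimeCount f N : ℝ) / N - ε ≤ (∏ i, ((f i).natDegree : ℝ)) * Real.log N' ^ k * (Literature.NumberTheory.Sieve.polyPrimeCount f N' : ℝ) / N' := by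
  intro k f hf ε hε
  have h3 : (0 : ℝ) < ε / 3 := by positivity
  obtain ⟨δ, hδ, N₂, hN₂⟩ := hS k f hf (ε / 3) h3
  obtain ⟨N₁, hN₁⟩ := Metric.tendsto_atTop.mp (h₁ k f hf) (ε / 3) h3
  refine ⟨δ, hδ, max N₁ N₂, fun N N' hN hNN' hN' => ?_⟩
  have hA := hN₁ N (le_of_max_le_left hN)
  have hB := hN₁ N' ((le_of_max_le_left hN).trans hNN')
  have hC := hN₂ N N' (le_of_max_le_right hN) hNN' hN'
  rw [Real.dist_eq, sub_zero, abs_lt] at hA hB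
  linarith [hA.1, hA.2, hB.1, hB.2, hC]

end Summit.Parity.BatemanHorn.Cruxes.SlowDecrease.Birth
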